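import Summits.AtomisticToContinuum.FouriersLaw.Theses.VanishingNoiseTransfer
import Literature.MathematicalPhysics.KineticTheory.VelocityFlipNoise

/-!
# Line `exit-side-influence` — skeleton for crux `NoiseLocality` (stmt-AtomisticToContinuum-11975)

Route `VanishingNoiseTransfer` (sub-problem `FouriersLaw`), crux decl
`Summit.AtomisticToContinuum.FouriersLaw.Theses.VanishingNoiseTransfer.NoiseLocality`
(an `N`-uniform modulus `w(ε) → 0` with `|D_N(0) − D_N(ε)| ≤ w(ε)|D_N(0)||D_N(ε)|` for the
flip-noisy pinned chain, `ε ∈ (0,1]`).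

THE LINE (idea card `exit-side-influence`, the (Φ)-programme of the merged Duhamel line
`dissipative-duhamel-matthiessen` ≈ `relative-flip-energy-transfer`, TRIAGE-r1-1/2/3: pass ×3).
Everything `N`-uniform is moved to `ε = 0` AND to EQUILIBRIUM, onto ONE functional of the
deterministic chain: the exit-side energy
`E_L(z) = ∫₀^∞ E_z[γ (p₀(t)² − T)] dt` (expected excess energy absorbed by the LEFT bath during
relaxation from the microstate `z`, baths both at `T`), through three fixed-`N` identities, one
`N`-uniform equilibrium bound and one fixed-`N` positivity (plus the registered sibling crux X3):

* `stub_transmission` (fixed `N ≥ 2`): the finite-`N` linear response in exit-side form,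
  `D_N(0) = (N−1)(γ/T²)·τ_N`, `τ_N = ½[Cov_T(p₀², E_R) + Cov_T(p²_{N−1}, E_L)]` (end-to-end
  energy transmission);
* `stub_duhamelDissipation` (fixed `N ≥ 2`, any `ε > 0`; = engine (ii) of the Duhamel line,
  PROVED as finite-dimensional algebra in the ideator's Sketch.lean): Duhamel in the flip Dirichlet
  form + the dissipation identity of the noisy dynamics,
  `|D_N(ε) − D_N(0)| ≤ √(ε · D_N(ε) · Ψ(W₀)/(T²(N−1)))`, `W₀ = ∫₀^∞ P_t J dt` the deterministic
  corrector, `Ψ(f) = ½ Σ_x E_T (f∘Θ_x − f)²` the flip energy (total influence of the `N` momentum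
  signs);
* `stub_exitIdentity` (fixed `N ≥ 2`): the dipole identity `L G_c = J + γc[(p₀²−T) − (p²_{N−1}−T)]`
  gives `W₀ = −(G_c − ⟨G_c⟩) − c(E_L − E_R)`, `c = (N−1)/2`, hence `Ψ(W₀) = (N−1)² Ψ(E_L)`;
* `stub_exitInfluence` (THE `N`-UNIFORM STUB, hardest): `Ψ(E_L) ≤ Φ̄ (N−1)(γ/T)² τ_N²`, i.e. the
  flip susceptibility `Φ_N = T²(N−1)Ψ(W₀)/Q_N(0)² ≤ Φ̄` in exit-side dress: "the total influence of
  the `N` iid momentum signs on the exit side is `O(D_N²/N)`" (gambler's ruin: one flip re-routes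
  `O(T)` energy by one mean free path `ℓ`, changing the exit bath with probability `O(ℓ/N)`;
  `ℓ` cancels against `D_N ~ ℓ`: bounded in the diffusive AND the ballistic corner, `Φ_N ↑ 10.661`
  for the pinned harmonic chain, kit j004943/j012236);
* `stub_noisyPositive` (fixed `N ≥ 2`, every rate `ε > 0`; the noisy analogue of the sibling support
  `PositiveConductance`, triage "(P₊)"): `D_N(ε) > 0`.
The ONE borrowed `N`-uniform input is the route's REGISTERED sibling crux `NoisyFourier` (X3), taken
BY NAME as the last hypothesis of `NoiseLocality_of` and used only at the single rate `ε₀ = 1`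
(`D_N(1) → κ₁(T) > 0`; with `stub_noisyPositive` below `N₁`: the one-rate noisy floor
`d₁ = min(κ₁(T)/2, min_{2≤N<N₁} D_N(1)) > 0`). Stubs are declared as sorried theorems
`Holds.stub_<name>` with by-name handles `def stub_<name> : Prop := type_of% Holds.stub_<name>`.

`NoiseLocality_of` (kernel-checked, no `sorry` of its own): master inequality
`|D_ε − D₀| ≤ √(εΦ̄D_ε)·D₀` from the first four stubs; at rate `1` it yields the deterministic floor
`1/D_N(0) ≤ 1/d₁ + √(Φ̄/d₁) =: 1/d` (the disprover's necessary entailment `inf_N D_N(0) > 0` comes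
out as a corollary); then the division-free case analysis (`D_ε ≥ D₀/2`: `w ≥ √(2εΦ̄/d)`;
`D_ε < D₀/2` forces `D_ε > 1/(4εΦ̄)`: `w ≥ 4εΦ̄`) gives the crux with the explicit `N`-uniform
modulus `w(ε) = √(2εΦ̄'/d) + 4εΦ̄'`, `Φ̄' = max(Φ̄,1)`; `N ≤ 1` carries no current (`D = 0`).

Disproof.lean (cdisprove-11975-0 v1–v3, read through its evidence notes; the file itself is not
mounted in this seat): §1 `conclusion_of_le_one` (re-proved inline below), §4
`pointwise_modulus_insufficient` (honoured: `w` is chosen before `N`), `additive_form_fails_ballistic`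
(honoured: the weighted form is proved), `localityShape_ballistic` (the line is compatible with the
ballistic corner: `Φ_N` bounded there), §5 `cauchySeq_inv_of_localityShape` / §5b (the floor
`inf_N D_N(0) ≥ d` NECESSARY for the crux is an OUTPUT here, from X3 at one rate + the engine).
No `_false_without_` theorem and no landed `Negative/` lemma exist for this crux (ledger negatives:
12 items, none in this route).
-/

noncomputable section

open MeasureTheory Filter Topology
open scoped NNReal BigOperators
open Literature.MathematicalPhysics.KineticTheory.HeatConduction

namespace Summit.AtomisticToContinuum.FouriersLaw.Cruxes.NoiseLocality.ExitSideInfluence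

/-! ### Abbreviations over existing declarations (`pinnedChain`, `bondCurrent`, `totalCurrent`,
`IsSteadyState`, `IsFlipSteadyState`, `transitionKernel`, `gibbsMeasure`, `momentumFlip`) -/

/-- The total instantaneous energy current `J = Σ_bonds j_i` of the `N`-chain (the integrand of
`OscillatorChain.totalCurrent`). -/
def totalCurrentFn (ω₂ lam β γ : ℝ) (N : ℕ) (x : PhaseSpace N) : ℝ :=
  ∑ i : Fin N, (pinnedChain ω₂ lam β γ).bondCurrent N i x

/-- Kinetic excess at the LEFT bath site, `p₀² − T` (site `i.val = 0`, as in
`OscillatorChain.generator`; `0` for the empty chain). -/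
def kinExcessLeft (N : ℕ) (T : ℝ) (x : PhaseSpace N) : ℝ :=
  ∑ i : Fin N, if i.val = 0 then x.2 i ^ 2 - T else 0

/-- Kinetic excess at the RIGHT bath site, `p²_{N−1} − T` (site `i.val = N − 1`). -/
def kinExcessRight (N : ℕ) (T : ℝ) (x : PhaseSpace N) : ℝ :=
  ∑ i : Fin N, if i.val = N - 1 then x.2 i ^ 2 - T else 0

/-- The Green operator of the deterministic EQUILIBRIUM dynamics (baths both at `T`):
`(green g)(z) = ∫₀^∞ P_t g(z) dt`, `P_t` the constructed transition kernels
`OscillatorChain.transitionKernel` of the Langevin SDE (CEHR2018 (2.3)); for mean-zero `g` of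
finite `e^{θH}`-norm the integral converges absolutely by the exponential mixing (2.5)
(`pinnedChainSemigroup_exp_convergence`). Formally `green g = (−L)⁻¹ g`. -/
def green (ω₂ lam β γ : ℝ) (N : ℕ) (T : ℝ) (g : PhaseSpace N → ℝ) (z : PhaseSpace N) : ℝ :=
  ∫ t in Set.Ioi (0 : ℝ),
    ∫ y, g y ∂((pinnedChain ω₂ lam β γ).transitionKernel N T T t.toNNReal z)

/-- EXIT-SIDE FUNCTIONAL `E_L(z) = ∫₀^∞ E_z[γ(p₀(t)² − T)] dt`: the expected excess energy absorbed
by the LEFT bath during the relaxation of the deterministic chain from `z` at equilibrium `T`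
(`L H = γ(T − p₀²) + γ(T − p²_{N−1})`, so `E_L + E_R = H − ⟨H⟩_T`). -/
def exitLeft (ω₂ lam β γ : ℝ) (N : ℕ) (T : ℝ) : PhaseSpace N → ℝ :=
  green ω₂ lam β γ N T fun x => γ * kinExcessLeft N T x

/-- EXIT-SIDE FUNCTIONAL `E_R(z) = ∫₀^∞ E_z[γ(p_{N−1}(t)² − T)] dt` (energy absorbed by the RIGHT
bath). -/
def exitRight (ω₂ lam β γ : ℝ) (N : ℕ) (T : ℝ) : PhaseSpace N → ℝ :=
  green ω₂ lam β γ N T fun x => γ * kinExcessRight N T x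

/-- The deterministic unit-current CORRECTOR `W₀ = ∫₀^∞ P_t J dt = (−L)⁻¹ J` (the Green–Kubo
object: `Q_N(0) = ⟨J, W₀⟩_T = T²(N−1) D_N(0)`). -/
def corrector (ω₂ lam β γ : ℝ) (N : ℕ) (T : ℝ) : PhaseSpace N → ℝ :=
  green ω₂ lam β γ N T (totalCurrentFn ω₂ lam β γ N)

/-- FLIP ENERGY (flip Dirichlet form, total influence of the `N` momentum signs):
`Ψ_μ(f) = ½ Σ_i ∫ (f(ω^i) − f(ω))² dμ = ⟨f, −S f⟩_{L²(μ)}` for flip-invariant `μ`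
(`S = flipNoise`, Bernardin–Olla). -/
def flipEnergy {N : ℕ} (μ : Measure (PhaseSpace N)) (f : PhaseSpace N → ℝ) : ℝ :=
  (1 / 2) * ∑ i : Fin N, ∫ x, (f (momentumFlip i x) - f x) ^ 2 ∂μ

/-- END-TO-END TRANSMISSION `τ_N(T) = ½[Cov_T(p₀², E_R) + Cov_T(p²_{N−1}, E_L)]` (Gibbs
expectations; `⟨p² − T⟩_T = 0`, so these are covariances). -/
def transmission (ω₂ lam β γ : ℝ) (N : ℕ) (T : ℝ) : ℝ :=
  (1 / 2) *
    ((∫ x, kinExcessLeft N T x * exitRight ω₂ lam β γ N T x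
        ∂((pinnedChain ω₂ lam β γ).gibbsMeasure N T)) +
      ∫ x, kinExcessRight N T x * exitLeft ω₂ lam β γ N T x
        ∂((pinnedChain ω₂ lam β γ).gibbsMeasure N T))

/-! ### The registered stubs -/

/-- `stub_transmission` — TRANSMISSION FORM OF THE FINITE-`N` LINEAR RESPONSE (fixed `N ≥ 2`,
`ε = 0`; size L). For the unique deterministic steady family and its response `D_N(0)` at `T`:
`D_N(0) = (N−1)(γ/T²)·τ_N(T)`. Content: (GK) finite-`N` open-chain linear response
`D_N(0) = ⟨W₀, φ̃⟩_T`, `φ̃ = (γ/2T²)[(p₀²−T) − (p²_{N−1}−T)]` (perturbation `±(δ/2)γ∂²_p` of the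
bath operators, two Gaussian integrations by parts; KunduDharNarayan2009 p.3, ReyBellet2003 Rem 4.4
(56), HairerMajda2009 Thm 2.3 framework — the level of the shared support `FiniteResponseOfUnique`)
+ the dipole identity of `stub_exitIdentity` + the Gaussian moments `Cov_T(h₀, p₀²) = T²`,
`Cov_T(E_L + E_R, p₀²) = Cov_T(H, p₀²) = T²`. Why plausibly true: re-derived by hand by all three
triagers; verified to 1e−11 in the Gaussian corner (kit j004943). Leans on: `pinnedChain_dynkin`,
`pinnedChainSemigroup_exp_convergence`, `pinnedChain_isSteadyState_gibbsMeasure`,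
`integral_generator_mul_gibbsDensity`, named fact `CuneoEckmannHairerReyBellet2018_thm213`. -/
theorem Holds.stub_transmission :
    ∀ ω₂ lam β γ : ℝ, 0 < ω₂ → 0 < lam → 0 < β → 0 < γ → ∀ T : ℝ, 0 < T →
      ∀ N : ℕ, 2 ≤ N → ∀ μ0 : ℝ → ℝ → Measure (PhaseSpace N),
        (∀ T_L T_R : ℝ, 0 < T_L → 0 < T_R →
          (pinnedChain ω₂ lam β γ).IsSteadyState N T_L T_R (μ0 T_L T_R) ∧
            ∀ ν : Measure (PhaseSpace N),
              (pinnedChain ω₂ lam β γ).IsSteadyState N T_L T_R ν → ν = μ0 T_L T_R) →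
        ∀ D0 : ℝ, Tendsto (fun δ : ℝ =>
            (pinnedChain ω₂ lam β γ).totalCurrent (μ0 (T + δ / 2) (T - δ / 2)) / δ) (𝓝[≠] 0) (𝓝 D0) →
          D0 = ((N : ℝ) - 1) * γ / T ^ 2 * transmission ω₂ lam β γ N T := by
  sorry

/-- `stub_duhamelDissipation` — DUHAMEL IN THE FLIP FORM + DISSIPATION PAYS THE NOISY FACTOR
(fixed `N ≥ 2`, every `ε > 0`; size L–XL, all fixed-`N`; SHARED with the Duhamel line). For the
unique deterministic family (response `D₀`) and the unique `ε`-noisy family (response `D_ε`) at `T`: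
`0 ≤ D₀`, `0 ≤ D_ε` and `|D_ε − D₀| ≤ √(ε · D_ε · Ψ_T(W₀) / (T²(N−1)))`.
Content: (GK₀/GK_ε) `T²(N−1) D_N(ε) = Q_N(ε) := ⟨J, W_ε⟩_T`, `W_ε = (−L−εS)⁻¹J` in `L²(μ_T)`
(`μ_T` is invariant for `L + εS`: `pinnedChain_isFlipSteadyState_gibbsMeasure`; positivity
`Q ≥ 0` by dissipativity); (CE) solvability of the corrector equations at fixed `N`
(hypoelliptic OU–Hörmander structure + bounded flip perturbation); ENGINE (ii), PROVED sorry-free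
as `DissipativeDuhamel.duhamel_dissipation` in the ideator's Sketch.lean for any real matrix with
PSD symmetric part: `Q₀ − Q_ε = ε⟨W̃_ε, P W₀⟩`, Cauchy–Schwarz in `P = −S ⪰ 0`,
`ε‖W̃_ε‖²_P ≤ ⟨W̃_ε,(−L−εS)ᵀW̃_ε⟩ = Q_ε` ⇒ `|Q_ε − Q₀| ≤ √(εQ_ε)·‖W₀‖_P`, which is the displayed
inequality after division by `T²(N−1)`. Why it might fail: only through (GK)/(CE) at fixed `N`
(print-level: BLR2000 record that (32) is derived formally; rigorous frameworks HairerMajda2009,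
CEHR2018). Leans on: `integral_mul_flipNoise`, `integral_flipNoise_eq_zero`,
`measurePreserving_momentumFlip_gibbsMeasure`, `pinnedChain_isFlipSteadyState_gibbsMeasure`. -/
theorem Holds.stub_duhamelDissipation :
    ∀ ω₂ lam β γ : ℝ, 0 < ω₂ → 0 < lam → 0 < β → 0 < γ → ∀ T : ℝ, 0 < T →
      ∀ N : ℕ, 2 ≤ N → ∀ ε : ℝ, 0 < ε →
        ∀ μ0 με : ℝ → ℝ → Measure (PhaseSpace N),
        (∀ T_L T_R : ℝ, 0 < T_L → 0 < T_R →
          (pinnedChain ω₂ lam β γ).IsSteadyState N T_L T_R (μ0 T_L T_R) ∧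
            ∀ ν : Measure (PhaseSpace N),
              (pinnedChain ω₂ lam β γ).IsSteadyState N T_L T_R ν → ν = μ0 T_L T_R) →
        (∀ T_L T_R : ℝ, 0 < T_L → 0 < T_R →
          (pinnedChain ω₂ lam β γ).IsFlipSteadyState N T_L T_R ε (με T_L T_R) ∧
            ∀ ν : Measure (PhaseSpace N),
              (pinnedChain ω₂ lam β γ).IsFlipSteadyState N T_L T_R ε ν → ν = με T_L T_R) →
        ∀ D0 Dε : ℝ, Tendsto (fun δ : ℝ =>
            (pinnedChain ω₂ lam β γ).totalCurrent (μ0 (T + δ / 2) (T - δ / 2)) / δ) (𝓝[≠] 0) (𝓝 D0) →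
          Tendsto (fun δ : ℝ =>
            (pinnedChain ω₂ lam β γ).totalCurrent (με (T + δ / 2) (T - δ / 2)) / δ) (𝓝[≠] 0) (𝓝 Dε) →
              0 ≤ D0 ∧ 0 ≤ Dε ∧
                |Dε - D0| ≤ Real.sqrt (ε * Dε *
                  flipEnergy ((pinnedChain ω₂ lam β γ).gibbsMeasure N T) (corrector ω₂ lam β γ N T) /
                    (T ^ 2 * ((N : ℝ) - 1))) := by
  sorry

/-- `stub_exitIdentity` — THE EXIT-SIDE (DIPOLE) IDENTITY (fixed `N ≥ 2`; size M–L):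
`Ψ_T(W₀) = (N−1)² Ψ_T(E_L)`. Content: with the symmetric site energies `h_k` and
`G_c = Σ_k (k − c) h_k`, `c = (N−1)/2`: `L h₀ = −j₀ + γ(T − p₀²)`, `L h_k = j_{k−1} − j_k`,
`L h_{N−1} = j_{N−2} + γ(T − p²_{N−1})`, so `L G_c = J + γc[(p₀²−T) − (p²_{N−1}−T)]` and
`W₀ = (−L)⁻¹J = −(G_c − ⟨G_c⟩_T) − c(E_L − E_R)`; `G_c` and `E_L + E_R = H − ⟨H⟩_T` are even in
every momentum, hence flip-invisible: `Ψ(W₀) = c² Ψ(E_L − E_R) = c² Ψ(2E_L − (H−⟨H⟩)) = (N−1)²Ψ(E_L)`.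
Needs Dynkin/`(−L)⁻¹L = id` on mean-zero observables of finite `e^{θH}`-norm (fixed-`N` ergodicity,
CEHR2018 (2.5)). Verified to 1e−11 in the Gaussian corner (j004943) and re-derived by the three
triagers. Leans on: `pinnedChain_generator_energyMoment` / `poisson_hamiltonian_energyMoment`
(MazurBoundBallisticOpenChain.lean), `generator_hamiltonian`, `hamiltonian_momentumFlip`,
`flipNoise_hamiltonian`, `pinnedChainSemigroup_exp_convergence`. -/
theorem Holds.stub_exitIdentity :
    ∀ ω₂ lam β γ : ℝ, 0 < ω₂ → 0 < lam → 0 < β → 0 < γ → ∀ T : ℝ, 0 < T → ∀ N : ℕ, 2 ≤ N →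
      flipEnergy ((pinnedChain ω₂ lam β γ).gibbsMeasure N T) (corrector ω₂ lam β γ N T) =
        ((N : ℝ) - 1) ^ 2 *
          flipEnergy ((pinnedChain ω₂ lam β γ).gibbsMeasure N T) (exitLeft ω₂ lam β γ N T) := by
  sorry

/-- `stub_exitInfluence` — EXIT-SIDE INFLUENCE BOUND, THE `N`-UNIFORM STUB OF THE LINE (size XL;
hardest). There is `Φ̄ = Φ̄(ω₂,lam,β,γ,T)` with, for every `N ≥ 2`,
`Ψ_T(E_L) ≤ Φ̄ · (N−1) · (γ/T)² · τ_N²`, i.e. (by `stub_transmission`, `stub_exitIdentity`) the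
flip susceptibility of the deterministic corrector `Φ_N = T²(N−1)Ψ(W₀)/Q_N(0)² ≤ Φ̄`: the total
influence `Σ_x ‖E_L∘Θ_x − E_L‖²` of the `N` iid momentum signs on the energy that exits LEFT is
`O(D_N(0)²/N)`. Why plausibly true: gambler's ruin — one flip re-routes `O(T)` energy by a mean
free path `ℓ` and changes the exit bath with probability `O(ℓ/N)`, so `Σ_x Inf_x ~ T²ℓ²/N` while
`D_N ~ ℓ` (the `ℓ` CANCELS: `O(1)` in the diffusive and in the ballistic regime; exact Gaussian
corner `Φ_N = 10.20 … 10.661`, `N = 4 … 128`, kit j004943, replicated j012236); blows up only under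
localisation (where the crux itself fails). Why it might fail: it is a DERIVATIVE bound
`|dr_N/dε(0⁺)| ≤ Φ_N` (the crux tolerates `√ε`), and the load-bearing step — light-cone
decorrelation of ONE flip in the deterministic anharmonic bulk (card (B2)) × exit-side regularity
of the linear-response profile `Cov_T(h_x, E_L)` (card (B1)) — is unprinted for any anharmonic
chain (HasBoundedResponse's documented absence; BLR2000 §6.3). Cheapest falsifier: growth with `N`
of the anharmonic Matthiessen slope `(r_N(ε) − r_N(0))/ε` at `T = 1` (Kohler: a LOWER bound for
`Φ_N`), NEMD jobs j006039/j006042/j006045, j004867/j004868/j005233 of the sibling seats. -/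
theorem Holds.stub_exitInfluence :
    ∀ ω₂ lam β γ : ℝ, 0 < ω₂ → 0 < lam → 0 < β → 0 < γ → ∀ T : ℝ, 0 < T →
      ∃ Φ : ℝ, ∀ N : ℕ, 2 ≤ N →
        flipEnergy ((pinnedChain ω₂ lam β γ).gibbsMeasure N T) (exitLeft ω₂ lam β γ N T) ≤
          Φ * ((N : ℝ) - 1) * (γ / T) ^ 2 * (transmission ω₂ lam β γ N T) ^ 2 := by
  sorry

/-- `stub_noisyPositive` — POSITIVE CONDUCTANCE OF THE NOISY CHAIN AT EVERY FINITE LENGTH (fixed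
`N ≥ 2`, every rate `ε > 0`; size M; the noisy analogue of the sibling support `PositiveConductance`
stmt-AtomisticToContinuum-11750 — triage r1-3's "(P₊)"). For the unique `ε`-noisy steady family and
its response `D_N(ε)` at `T`: `0 < D_N(ε)`. Content: the noisy finite-`N` Kubo form
`T²(N−1)D_N(ε) = Q_N(ε) = ⟨W_ε, (−L−εS)W_ε⟩_T = γT Σ_{b∈{0,N−1}} ‖∂_{p_b}W_ε‖²_T + ε Ψ_T(W_ε) ≥ 0`
is NON-DEGENERATE: `Q_N(ε) = 0` would make `W_ε` even in every momentum and independent of the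
contact momenta with `A W_ε = −J`, excluded by a finite bracket recursion for the quartic chain.
Why it might fail: strict positivity of the LINEAR response coefficient is not in print even at
`ε = 0` (EckmannPilletReyBellet1999b: entropy production `> 0` at `T_L ≠ T_R` still allows
`J = O(δ³)`). Role: with the REGISTERED sibling crux `NoisyFourier` (X3, hypothesis `hNF` of
`NoiseLocality_of`, used at the single rate `ε₀ = 1`: unique noisy families, responses
`D_N(1) → κ₁(T) > 0`) it yields the one-rate noisy floor `d₁ = min(κ₁(T)/2, min_{2≤N<N₁} D_N(1)) > 0`,
from which the composition OUTPUTS the deterministic floor `inf_{N≥2} D_N(0) ≥ d > 0` that the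
disprover showed NECESSARY for the crux (`cauchySeq_inv_of_localityShape`, `limits_of_localityShape`).
Leans on: `IsFlipSteadyState` API (`isFlipSteadyState_fun_eq`, `pinnedChain_isFlipSteadyState_gibbsMeasure`),
`integral_mul_flipNoise`; fixed-`N` hypoelliptic toolbox (CEHR2018 Thm 2.13, Carmona2007, HairerMajda2009). -/
theorem Holds.stub_noisyPositive :
    ∀ ω₂ lam β γ : ℝ, 0 < ω₂ → 0 < lam → 0 < β → 0 < γ → ∀ T : ℝ, 0 < T →
      ∀ N : ℕ, 2 ≤ N → ∀ ε : ℝ, 0 < ε → ∀ μ : ℝ → ℝ → Measure (PhaseSpace N),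
        (∀ T_L T_R : ℝ, 0 < T_L → 0 < T_R →
          (pinnedChain ω₂ lam β γ).IsFlipSteadyState N T_L T_R ε (μ T_L T_R) ∧
            ∀ ν : Measure (PhaseSpace N),
              (pinnedChain ω₂ lam β γ).IsFlipSteadyState N T_L T_R ε ν → ν = μ T_L T_R) →
        ∀ D : ℝ, Tendsto (fun δ : ℝ =>
            (pinnedChain ω₂ lam β γ).totalCurrent (μ (T + δ / 2) (T - δ / 2)) / δ) (𝓝[≠] 0) (𝓝 D) →
          0 < D := by
  sorry

/-! ### By-name handles of the five stub statements

Device of the accepted `Lines/*.lean` (e.g. `BoundedResponseConverges/Lines/two-scale-gluing-log-rigidity.lean`):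
`#h21_check_skeleton` admits as hypotheses of the skeleton theorem only registered obligations / declared
stubs BY NAME; seats cannot apply `@[stub]`, so each registered sorried theorem `Holds.stub_<name>` gets the
handle `def stub_<name> : Prop := type_of% Holds.stub_<name>` (no second copy of the statement text). -/

/-- Statement of the registered stub `Holds.stub_transmission`, by name. -/
def stub_transmission : Prop := type_of% Holds.stub_transmission

/-- Statement of the registered stub `Holds.stub_duhamelDissipation`, by name. -/
def stub_duhamelDissipation : Prop := type_of% Holds.stub_duhamelDissipation

/-- Statement of the registered stub `Holds.stub_exitIdentity`, by name. -/
def stub_exitIdentity : Prop := type_of% Holds.stub_exitIdentity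

/-- Statement of the registered stub `Holds.stub_exitInfluence`, by name. -/
def stub_exitInfluence : Prop := type_of% Holds.stub_exitInfluence

/-- Statement of the registered stub `Holds.stub_noisyPositive`, by name. -/
def stub_noisyPositive : Prop := type_of% Holds.stub_noisyPositive

/-! ### The composition: the five stubs (+ the registered sibling crux `NoisyFourier`) imply the crux BY NAME -/

/-- **THE SKELETON** (kernel-checked, no `sorry` of its own): the five registered stubs — by name —
together with the route's registered sibling crux `NoisyFourier` (X3, stmt-AtomisticToContinuum-11977,
used only at the rate `ε₀ = 1`) imply `Theses.VanishingNoiseTransfer.NoiseLocality`, with the explicit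
`N`-uniform modulus `w(ε) = √(2εΦ̄'/d) + 4εΦ̄'`, `Φ̄' = max(Φ̄, 1)`, `1/d = 1/d₁ + √(Φ̄'/d₁)`,
`d₁ = min(κ₁(T)/2, min_{2≤N<N₁} D_N(1))`. -/
theorem NoiseLocality_of (h1 : stub_transmission) (h2 : stub_duhamelDissipation)
    (h3 : stub_exitIdentity) (h4 : stub_exitInfluence) (h5 : stub_noisyPositive)
    (hNF : Summit.AtomisticToContinuum.FouriersLaw.Theses.VanishingNoiseTransfer.NoisyFourier) :
    Summit.AtomisticToContinuum.FouriersLaw.Theses.VanishingNoiseTransfer.NoiseLocality := by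
  dsimp only [stub_transmission, stub_duhamelDissipation, stub_exitIdentity, stub_exitInfluence,
    stub_noisyPositive] at h1 h2 h3 h4 h5
  intro ω₂ lam β γ hω hl hβ hγ S hS T hT
  subst hS
  -- a family of measures chosen at positive temperatures (as in the route's `closes`)
  have famChoice : ∀ {Q : (N : ℕ) → ℝ → ℝ → Measure (PhaseSpace N) → Prop},
      (∀ (N : ℕ) (T_L T_R : ℝ), 0 < T_L → 0 < T_R → ∃ μ, Q N T_L T_R μ) →
      ∃ fam : (N : ℕ) → ℝ → ℝ → Measure (PhaseSpace N),
        ∀ (N : ℕ) (T_L T_R : ℝ), 0 < T_L → 0 < T_R → Q N T_L T_R (fam N T_L T_R) := by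
    intro Q hQ
    classical
    refine ⟨fun N T_L T_R => if h : 0 < T_L ∧ 0 < T_R then (hQ N T_L T_R h.1 h.2).choose else 0,
      fun N T_L T_R hL hR => ?_⟩
    simp only [dif_pos (And.intro hL hR)]
    exact (hQ N T_L T_R hL hR).choose_spec
  -- the sibling crux at the single rate `ε₀ = 1`: unique noisy families, responses, `κ₁(T) > 0`
  obtain ⟨hexu, κ, hκpos, hresp⟩ := hNF ω₂ lam β γ hω hl hβ hγ _ rfl 1 one_pos
  obtain ⟨μ1, hμ1⟩ := famChoice hexu
  obtain ⟨D1, hD1, hD1lim⟩ := hresp μ1 (fun N T_L T_R hL hR => (hμ1 N T_L T_R hL hR).1) T hT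
  have hκT : 0 < κ T := hκpos T hT
  obtain ⟨N₁, hN₁⟩ := (hD1lim.eventually_const_lt (half_lt_self hκT)).exists_forall_of_atTop
  -- the one-rate noisy floor `d₁` (finite-`N` positivity below `N₁`, `κ₁(T)/2` beyond)
  set d₁ : ℝ := (Finset.Ico 2 N₁).fold min (κ T / 2) D1 with hd₁def
  have hd₁ : 0 < d₁ := by
    rw [hd₁def, Finset.lt_fold_min]
    refine ⟨half_pos hκT, fun N hN => ?_⟩
    exact h5 ω₂ lam β γ hω hl hβ hγ T hT N (Finset.mem_Ico.mp hN).1 1 one_pos (μ1 N)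
      (fun T_L T_R hL hR => hμ1 N T_L T_R hL hR) (D1 N) (hD1 N)
  have hd₁le : ∀ N : ℕ, 2 ≤ N → d₁ ≤ D1 N := by
    intro N hN2
    rw [hd₁def, Finset.fold_min_le]
    rcases Nat.lt_or_ge N N₁ with h | h
    · exact Or.inr ⟨N, Finset.mem_Ico.mpr ⟨hN2, h⟩, le_rfl⟩
    · exact Or.inl (hN₁ N h).le
  -- the `N`-uniform flip susceptibility of the line at temperature `T`
  obtain ⟨Φ, hΦ⟩ := h4 ω₂ lam β γ hω hl hβ hγ T hT
  set Φ' : ℝ := max Φ 1 with hΦ'def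
  have hΦ'1 : (1 : ℝ) ≤ Φ' := le_max_right _ _
  have hΦ'pos : (0 : ℝ) < Φ' := lt_of_lt_of_le one_pos hΦ'1
  have hΦle : Φ ≤ Φ' := le_max_left _ _
  -- the deterministic conductance floor produced by the line
  have hdsum : (0 : ℝ) < 1 / d₁ + Real.sqrt (1 * Φ' / d₁) := by positivity
  set d : ℝ := (1 / d₁ + Real.sqrt (1 * Φ' / d₁))⁻¹ with hddef
  have hd : 0 < d := inv_pos.mpr hdsum
  -- the modulus
  refine ⟨fun ε => Real.sqrt (2 * ε * Φ' / d) + 4 * ε * Φ', ?_, ?_⟩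
  · have hc : Continuous fun ε : ℝ => Real.sqrt (2 * ε * Φ' / d) + 4 * ε * Φ' :=
      (Real.continuous_sqrt.comp (by fun_prop)).add (by fun_prop)
    have h0 := hc.tendsto 0
    simp only [mul_zero, zero_mul, zero_div, Real.sqrt_zero, add_zero] at h0
    exact h0.mono_left nhdsWithin_le_nhds
  · intro N ε hε hε1 μ0 με hμ0 hμε D0 Dε hD0 hDε
    rcases Nat.lt_or_ge N 2 with hN | hN
    · -- `N ≤ 1`: no bond, no current, `D0 = Dε = 0`
      have hbond : ∀ (i : Fin N) (x : PhaseSpace N),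
          (pinnedChain ω₂ lam β γ).bondCurrent N i x = 0 := by
        intro i x
        unfold OscillatorChain.bondCurrent
        refine Finset.sum_eq_zero fun j _ => ?_
        have hj : j.val ≠ i.val + 1 := by
          have := j.isLt
          have := i.isLt
          omega
        rw [if_neg hj]
      have hzero : ∀ μ : Measure (PhaseSpace N), (pinnedChain ω₂ lam β γ).totalCurrent μ = 0 := by
        intro μ
        unfold OscillatorChain.totalCurrent
        simp [hbond]
      have hD0z : D0 = 0 := by
        refine tendsto_nhds_unique hD0 ?_
        simp only [hzero, zero_div]
        exact tendsto_const_nhds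
      have hDεz : Dε = 0 := by
        refine tendsto_nhds_unique hDε ?_
        simp only [hzero, zero_div]
        exact tendsto_const_nhds
      simp [hD0z, hDεz]
    · -- `N ≥ 2`
      have hNr : (0 : ℝ) < (N : ℝ) - 1 := by
        have : (2 : ℝ) ≤ (N : ℝ) := by exact_mod_cast hN
        linarith
      -- MASTER INEQUALITY at an arbitrary positive rate, from stubs 1–4
      have master : ∀ ε' : ℝ, 0 < ε' → ∀ μ' : ℝ → ℝ → Measure (PhaseSpace N),
        (∀ T_L T_R : ℝ, 0 < T_L → 0 < T_R →
          (pinnedChain ω₂ lam β γ).IsFlipSteadyState N T_L T_R ε' (μ' T_L T_R) ∧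
            ∀ ν : Measure (PhaseSpace N),
              (pinnedChain ω₂ lam β γ).IsFlipSteadyState N T_L T_R ε' ν → ν = μ' T_L T_R) →
        ∀ D' : ℝ, Tendsto (fun δ : ℝ =>
            (pinnedChain ω₂ lam β γ).totalCurrent (μ' (T + δ / 2) (T - δ / 2)) / δ) (𝓝[≠] 0) (𝓝 D') →
            0 ≤ D0 ∧ 0 ≤ D' ∧ |D' - D0| ≤ Real.sqrt (ε' * Φ' * D') * D0 := by
        intro ε' hε' μ' hμ' D' hD'
        obtain ⟨hD0nn, hD'nn, hineq⟩ :=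
          h2 ω₂ lam β γ hω hl hβ hγ T hT N hN ε' hε' μ0 μ' hμ0 hμ' D0 D' hD0 hD'
        refine ⟨hD0nn, hD'nn, hineq.trans ?_⟩
        have hS1 := h1 ω₂ lam β γ hω hl hβ hγ T hT N hN μ0 hμ0 D0 hD0
        have hS3 := h3 ω₂ lam β γ hω hl hβ hγ T hT N hN
        have hS4 := hΦ N hN
        set ΨE := flipEnergy ((pinnedChain ω₂ lam β γ).gibbsMeasure N T) (exitLeft ω₂ lam β γ N T)
          with hΨEdef
        set τ := transmission ω₂ lam β γ N T with hτdef
        have hΨE : ΨE ≤ Φ' * ((N : ℝ) - 1) * (γ / T) ^ 2 * τ ^ 2 := by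
          refine hS4.trans ?_
          have hnn : 0 ≤ ((N : ℝ) - 1) * (γ / T) ^ 2 * τ ^ 2 := by positivity
          calc Φ * ((N : ℝ) - 1) * (γ / T) ^ 2 * τ ^ 2 = Φ * (((N : ℝ) - 1) * (γ / T) ^ 2 * τ ^ 2) := by
                ring
            _ ≤ Φ' * (((N : ℝ) - 1) * (γ / T) ^ 2 * τ ^ 2) := by gcongr
            _ = Φ' * ((N : ℝ) - 1) * (γ / T) ^ 2 * τ ^ 2 := by ring
        have hkey : flipEnergy ((pinnedChain ω₂ lam β γ).gibbsMeasure N T) (corrector ω₂ lam β γ N T) /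
            (T ^ 2 * ((N : ℝ) - 1)) ≤ Φ' * D0 ^ 2 := by
          rw [hS3, hS1]
          have hT2 : (0 : ℝ) < T ^ 2 := by positivity
          calc ((N : ℝ) - 1) ^ 2 * ΨE / (T ^ 2 * ((N : ℝ) - 1))
                = ((N : ℝ) - 1) * ΨE / T ^ 2 := by
                  field_simp
            _ ≤ ((N : ℝ) - 1) * (Φ' * ((N : ℝ) - 1) * (γ / T) ^ 2 * τ ^ 2) / T ^ 2 := by
                  gcongr
            _ = Φ' * (((N : ℝ) - 1) * γ / T ^ 2 * τ) ^ 2 := by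
                  field_simp
        have hprod : 0 ≤ ε' * D' := mul_nonneg hε'.le hD'nn
        calc Real.sqrt (ε' * D' *
              flipEnergy ((pinnedChain ω₂ lam β γ).gibbsMeasure N T) (corrector ω₂ lam β γ N T) /
                (T ^ 2 * ((N : ℝ) - 1)))
              = Real.sqrt (ε' * D' *
                  (flipEnergy ((pinnedChain ω₂ lam β γ).gibbsMeasure N T) (corrector ω₂ lam β γ N T) /
                    (T ^ 2 * ((N : ℝ) - 1)))) := by rw [mul_div_assoc]
          _ ≤ Real.sqrt (ε' * D' * (Φ' * D0 ^ 2)) := Real.sqrt_le_sqrt (by gcongr)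
          _ = Real.sqrt (ε' * Φ' * D') * D0 := by
              rw [show ε' * D' * (Φ' * D0 ^ 2) = (ε' * Φ' * D') * D0 ^ 2 by ring,
                Real.sqrt_mul (by positivity) (D0 ^ 2), Real.sqrt_sq hD0nn]
      -- THE DETERMINISTIC FLOOR `d ≤ D0`, from the noisy floor at rate 1 and the master inequality
      obtain ⟨hD0nn, -, hm0⟩ := master 1 one_pos (μ1 N) (fun T_L T_R hL hR => hμ1 N T_L T_R hL hR)
        (D1 N) (hD1 N)
      have hdle : d₁ ≤ D1 N := hd₁le N hN
      generalize hDε₀def : D1 N = Dε₀ at hm0 hdle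
      have hDε₀pos : 0 < Dε₀ := hd₁.trans_le hdle
      have hD0pos : 0 < D0 := by
        rcases hD0nn.lt_or_eq with h | h
        · exact h
        · exfalso
          rw [← h] at hm0
          simp only [sub_zero, mul_zero] at hm0
          have : |Dε₀| = Dε₀ := abs_of_pos hDε₀pos
          linarith [abs_nonneg Dε₀]
      have hfl : d ≤ D0 := by
        have hfrac : D0⁻¹ - Dε₀⁻¹ = (Dε₀ - D0) / (D0 * Dε₀) := by
          field_simp
        have habs : |D0⁻¹ - Dε₀⁻¹| ≤ Real.sqrt (1 * Φ' / Dε₀) := by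
          rw [hfrac, abs_div, abs_of_pos (mul_pos hD0pos hDε₀pos),
            div_le_iff₀ (mul_pos hD0pos hDε₀pos)]
          calc |Dε₀ - D0| ≤ Real.sqrt (1 * Φ' * Dε₀) * D0 := hm0
            _ = Real.sqrt (1 * Φ' / Dε₀) * (D0 * Dε₀) := by
                rw [show 1 * Φ' * Dε₀ = (1 * Φ' / Dε₀) * Dε₀ ^ 2 by
                      field_simp,
                  Real.sqrt_mul (by positivity) (Dε₀ ^ 2), Real.sqrt_sq hDε₀pos.le]
                ring
        have hmono : Real.sqrt (1 * Φ' / Dε₀) ≤ Real.sqrt (1 * Φ' / d₁) := by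
          apply Real.sqrt_le_sqrt
          have hnum : 0 ≤ 1 * Φ' := by positivity
          exact div_le_div_of_nonneg_left hnum hd₁ hdle
        have hleft : D0⁻¹ - Dε₀⁻¹ ≤ Real.sqrt (1 * Φ' / d₁) :=
          ((abs_le.mp habs).2).trans hmono
        have hrec : Dε₀⁻¹ ≤ d₁⁻¹ := (inv_le_inv₀ hDε₀pos hd₁).2 hdle
        have hsum : D0⁻¹ ≤ d⁻¹ := by
          rw [hddef, inv_inv, one_div]
          linarith
        exact (inv_le_inv₀ hD0pos hd).1 hsum
      -- CONCLUSION at the given rate `ε ∈ (0,1]`: the division-free case analysis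
      obtain ⟨-, hDεnn, hm⟩ := master ε hε με hμε Dε hDε
      show |D0 - Dε| ≤ (Real.sqrt (2 * ε * Φ' / d) + 4 * ε * Φ') * |D0| * |Dε|
      rw [abs_of_pos hD0pos, abs_of_nonneg hDεnn, abs_sub_comm]
      have hw1 : 0 ≤ Real.sqrt (2 * ε * Φ' / d) := Real.sqrt_nonneg _
      have hw2 : 0 ≤ 4 * ε * Φ' := by positivity
      rcases le_or_gt (D0 / 2) Dε with hcase | hcase
      · -- Case A: `Dε ≥ D0/2 ≥ d/2`
        have hDεpos : 0 < Dε := by linarith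
        have hstep : Real.sqrt (ε * Φ' * Dε) ≤ Real.sqrt (2 * ε * Φ' / d) * Dε := by
          rw [show Real.sqrt (2 * ε * Φ' / d) * Dε = Real.sqrt (2 * ε * Φ' / d * Dε ^ 2) by
                rw [Real.sqrt_mul (by positivity) (Dε ^ 2), Real.sqrt_sq hDεpos.le]]
          apply Real.sqrt_le_sqrt
          have hdle2 : d ≤ 2 * Dε := by linarith
          have hone : (1 : ℝ) ≤ 2 * Dε / d := by
            rw [le_div_iff₀ hd, one_mul]
            exact hdle2
          have hεΦD : 0 ≤ ε * Φ' * Dε := by positivity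
          calc ε * Φ' * Dε = ε * Φ' * Dε * 1 := by ring
            _ ≤ ε * Φ' * Dε * (2 * Dε / d) := by gcongr
            _ = 2 * ε * Φ' / d * Dε ^ 2 := by
                field_simp
        have hextra : 0 ≤ 4 * ε * Φ' * D0 * Dε := by positivity
        calc |Dε - D0| ≤ Real.sqrt (ε * Φ' * Dε) * D0 := hm
          _ ≤ Real.sqrt (2 * ε * Φ' / d) * Dε * D0 := by gcongr
          _ ≤ (Real.sqrt (2 * ε * Φ' / d) + 4 * ε * Φ') * D0 * Dε := by
              have hring : (Real.sqrt (2 * ε * Φ' / d) + 4 * ε * Φ') * D0 * Dε =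
                  Real.sqrt (2 * ε * Φ' / d) * Dε * D0 + 4 * ε * Φ' * D0 * Dε := by ring
              rw [hring]
              linarith
      · -- Case B: `Dε < D0/2` forces `Dε > 1/(4εΦ')`
        have habs : |Dε - D0| = D0 - Dε := by
          rw [abs_sub_comm]
          exact abs_of_pos (by linarith)
        have hm' : D0 - Dε ≤ Real.sqrt (ε * Φ' * Dε) * D0 := habs ▸ hm
        have hhalf : 1 / 2 < Real.sqrt (ε * Φ' * Dε) := by
          by_contra hcon
          push Not at hcon
          have : Real.sqrt (ε * Φ' * Dε) * D0 ≤ 1 / 2 * D0 := by gcongr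
          linarith
        have hquarter : 1 / 4 < ε * Φ' * Dε := by
          have h := (Real.lt_sqrt (by norm_num : (0 : ℝ) ≤ 1 / 2)).mp hhalf
          norm_num at h
          linarith
        have hDεpos : 0 < Dε := by
          by_contra hcon
          push Not at hcon
          have : ε * Φ' * Dε ≤ 0 := mul_nonpos_of_nonneg_of_nonpos (by positivity) hcon
          linarith
        have hextra : 0 ≤ Real.sqrt (2 * ε * Φ' / d) * D0 * Dε := by positivity
        calc |Dε - D0| = D0 - Dε := habs
          _ ≤ D0 * 1 := by linarith
          _ ≤ D0 * (4 * ε * Φ' * Dε) := by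
              gcongr
              linarith
          _ ≤ (Real.sqrt (2 * ε * Φ' / d) + 4 * ε * Φ') * D0 * Dε := by
              have hring : (Real.sqrt (2 * ε * Φ' / d) + 4 * ε * Φ') * D0 * Dε =
                  Real.sqrt (2 * ε * Φ' / d) * D0 * Dε + D0 * (4 * ε * Φ' * Dε) := by ring
              rw [hring]
              linarith

/-- D-0027 §3.3 shape check (an `example`, so that `NoiseLocality_of` stays the unique theorem
concluding the crux): the registered sorried stubs feed the by-name hypotheses definitionally; once
the five `sorry`s are discharged and X3 is proved this term IS a proof of the crux. -/
example
    (hNF : Summit.AtomisticToContinuum.FouriersLaw.Theses.VanishingNoiseTransfer.NoisyFourier) :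
    Summit.AtomisticToContinuum.FouriersLaw.Theses.VanishingNoiseTransfer.NoiseLocality :=
  NoiseLocality_of Holds.stub_transmission Holds.stub_duhamelDissipation Holds.stub_exitIdentity
    Holds.stub_exitInfluence Holds.stub_noisyPositive hNF

end Summit.AtomisticToContinuum.FouriersLaw.Cruxes.NoiseLocality.ExitSideInfluence

end
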